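import Summits.CriticalPhenomena.CardyFormulaZ2.Theorems.CardyComplexConeParafermionToSLESixFamiliesDiamondDefs
import HarnessLib

/-!
# Line `potential-darboux-picard-diamond`, stub S4 (`stub_identifyPotential`): Arzelà–Ascoli on varying grids

Helper file of the stub `stub_identifyPotential` of crux `ParafermionToSLESixFamilies` (stmt-CriticalPhenomena-11389).
Step (i) of the identification extracts, from clause (a) of `ClosedPrecompactness` (S3: asymptotic equicontinuity of the
renormalised face potentials `δ^{2/3}Ψ` on the cells of the CLOSED diamond) and the density of the cells in the closed
diamond, a subsequence along which `δ^{2/3}Ψ − z_k` converges UNIFORMLY ON ALL CELLS to a function `G` continuous on the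
closed diamond (`IsPotentialLimit` + the uniform clause of `PotentialConformalLimit`). The functions live on varying finite
grids, so Mathlib's Arzelà–Ascoli (`BoundedContinuousFunction.arzela_ascoli`) does not apply verbatim; this file proves the
needed abstract packaging `subseqLimit_of_asympEquicontinuous` (registered helper of the crux item): on a compact
preconnected `X ⊆ ℂ`, functions `g_k` given on asymptotically dense subsets `S_k ⊆ X` and asymptotically equicontinuous
there admit a subsequence, additive constants `z_k` and a continuous `G` on `X` with `g_{s k} − z_k → G` uniformly on
`S_{s k}`. Proof: chains of uniformly bounded length (preconnectedness + compactness) bound the oscillation; a nearest-point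
extension to `X`, a countable dense subset and sequential compactness of `ℕ → closedBall 0 B` give pointwise convergence on
the dense set along a subsequence; asymptotic equicontinuity upgrades it to a uniform Cauchy property on `X`.
-/

noncomputable section

namespace Summit.CriticalPhenomena.CardyFormulaZ2.Cruxes.ParafermionToSLESixFamilies.PotentialDarbouxPicardDiamond

open scoped Topology
open Filter Set Metric

/-- Concatenating an `η`-chain of length `m` from `a` to `b` with one more step of length `< η` to `c`. -/
theorem chain_snoc {X : Set ℂ} {η : ℝ} {a b c : ℂ} {m : ℕ} {p : ℕ → ℂ} (hp0 : p 0 = a) (hpm : p m = b)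
    (hpX : ∀ i ≤ m, p i ∈ X) (hpd : ∀ i < m, dist (p i) (p (i + 1)) < η) (hc : c ∈ X) (hbc : dist b c < η) :
    ∃ q : ℕ → ℂ, q 0 = a ∧ q (m + 1) = c ∧ (∀ i ≤ m + 1, q i ∈ X) ∧ ∀ i < m + 1, dist (q i) (q (i + 1)) < η := by
  refine ⟨fun i => if i ≤ m then p i else c, by simp [hp0], by simp, fun i hi => ?_, fun i hi => ?_⟩
  · by_cases h : i ≤ m
    · simp only [h, if_true]; exact hpX i h
    · simp only [h, if_false]; exact hc
  · by_cases h : i + 1 ≤ m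
    · have h' : i ≤ m := by omega
      simp only [h, h', if_true]; exact hpd i (by omega)
    · have h' : i = m := by omega
      subst h'
      simp only [le_refl, if_true, h, if_false, hpm]; exact hbc

/-- Concatenation of two `η`-chains. -/
theorem chain_append {X : Set ℂ} {η : ℝ} {a b c : ℂ} {m m' : ℕ} {p q : ℕ → ℂ} (hp0 : p 0 = a) (hpm : p m = b)
    (hpX : ∀ i ≤ m, p i ∈ X) (hpd : ∀ i < m, dist (p i) (p (i + 1)) < η) (hq0 : q 0 = b) (hqm : q m' = c)
    (hqX : ∀ i ≤ m', q i ∈ X) (hqd : ∀ i < m', dist (q i) (q (i + 1)) < η) :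
    ∃ r : ℕ → ℂ, ∃ n : ℕ, r 0 = a ∧ r n = c ∧ (∀ i ≤ n, r i ∈ X) ∧ ∀ i < n, dist (r i) (r (i + 1)) < η := by
  induction m' generalizing c with
  | zero => exact ⟨p, m, hp0, by rw [hpm, ← hq0, hqm], hpX, hpd⟩
  | succ m' ih =>
    obtain ⟨r, n, hr0, hrn, hrX, hrd⟩ := ih rfl (fun i hi => hqX i (Nat.le_succ_of_le hi))
      (fun i hi => hqd i (Nat.lt_succ_of_lt hi))
    obtain ⟨r', hr'0, hr'n, hr'X, hr'd⟩ := chain_snoc hr0 hrn hrX hrd (hqm ▸ hqX (m' + 1) le_rfl)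
      (by rw [← hqm]; exact hqd m' (Nat.lt_succ_self _))
    exact ⟨r', n + 1, hr'0, hr'n, hr'X, hr'd⟩

/-- **Arzelà–Ascoli on varying grids (asymptotically equicontinuous version).** On a compact preconnected `X ⊆ ℂ`, let
`g_k` be functions given on subsets `S_k ⊆ X` which are asymptotically dense in `X` (every point of `X` is eventually
within any `η > 0` of `S_k`) and asymptotically equicontinuous on `S_k` (for every `ε > 0` some `η > 0` works for all
large `k`). Then along a subsequence `s`, after subtracting constants `z_k`, the `g_{s k}` converge UNIFORMLY ON `S_{s k}`
to a function `G` continuous on `X`. -/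
theorem subseqLimit_of_asympEquicontinuous : ∀ (X : Set ℂ) (S : ℕ → Set ℂ) (g : ℕ → ℂ → ℂ), IsCompact X → IsPreconnected X → (∀ k, S k ⊆ X) → (∀ ε > (0:ℝ), ∃ η > (0:ℝ), ∀ᶠ k in atTop, ∀ x ∈ S k, ∀ y ∈ S k, dist x y < η → ‖g k x - g k y‖ ≤ ε) → (∀ η > (0:ℝ), ∀ᶠ k in atTop, ∀ x ∈ X, ∃ y ∈ S k, dist x y < η) → ∃ (s : ℕ → ℕ) (z : ℕ → ℂ) (G : ℂ → ℂ), StrictMono s ∧ ContinuousOn G X ∧ ∀ ε > (0:ℝ), ∀ᶠ k in atTop, ∀ x ∈ S (s k), ‖g (s k) x - z k - G x‖ ≤ ε := by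
  intro X S g hXc hXp hSX hequi hdense
  rcases X.eq_empty_or_nonempty with hXe | ⟨x₀, hx₀⟩
  · refine ⟨id, 0, 0, strictMono_id, continuousOn_const, fun ε _ => Eventually.of_forall fun k x hx => ?_⟩
    have := hSX k hx
    rw [hXe] at this
    exact this.elim
  classical
  /- Step A: nearest-point projections `π k x ∈ S k`, eventually uniformly close to `x ∈ X`. -/
  have hSne : ∀ᶠ k in atTop, (S k).Nonempty := by
    filter_upwards [hdense 1 one_pos] with k hk
    obtain ⟨y, hy, -⟩ := hk x₀ hx₀
    exact ⟨y, hy⟩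
  let π : ℕ → ℂ → ℂ := fun k x =>
    if h : ∃ y ∈ S k, dist x y < infDist x (S k) + 1 / ((k : ℝ) + 1) then h.choose else x
  have hπS : ∀ k, (S k).Nonempty → ∀ x, π k x ∈ S k ∧ dist x (π k x) < infDist x (S k) + 1 / ((k : ℝ) + 1) := by
    intro k hk x
    have h : ∃ y ∈ S k, dist x y < infDist x (S k) + 1 / ((k : ℝ) + 1) :=
      (infDist_lt_iff hk).1 (lt_add_of_pos_right _ (by positivity))
    simp only [π, dif_pos h]
    exact h.choose_spec
  have hπ : ∀ η > (0:ℝ), ∀ᶠ k in atTop, ∀ x ∈ X, π k x ∈ S k ∧ dist x (π k x) < η := by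
    intro η hη
    have h1 : ∀ᶠ k : ℕ in atTop, 1 / ((k : ℝ) + 1) < η / 2 :=
      (tendsto_one_div_add_atTop_nhds_zero_nat (𝕜 := ℝ)).eventually (gt_mem_nhds (half_pos hη))
    filter_upwards [hSne, hdense (η / 2) (half_pos hη), h1] with k hk hd h1k
    intro x hx
    obtain ⟨hmem, hdist⟩ := hπS k hk x
    refine ⟨hmem, ?_⟩
    obtain ⟨y, hy, hxy⟩ := hd x hx
    have : infDist x (S k) ≤ dist x y := infDist_le_dist_of_mem hy
    linarith
  /- Step B: `η₁/2`-chains from `x₀` of uniformly bounded length, and the oscillation bound. -/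
  obtain ⟨η₁, hη₁, hequi₁⟩ := hequi 1 one_pos
  have hreach : ∀ x ∈ X, ∃ m : ℕ, ∃ p : ℕ → ℂ, p 0 = x₀ ∧ p m = x ∧ (∀ i ≤ m, p i ∈ X) ∧
      ∀ i < m, dist (p i) (p (i + 1)) < η₁ / 2 := by
    intro x hx
    let P : ℂ → ℂ → Prop := fun a b => ∃ m : ℕ, ∃ p : ℕ → ℂ, p 0 = a ∧ p m = b ∧ (∀ i ≤ m, p i ∈ X) ∧
      ∀ i < m, dist (p i) (p (i + 1)) < η₁ / 2
    have hrefl : ∀ a ∈ X, P a a := fun a ha =>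
      ⟨0, fun _ => a, rfl, rfl, fun i _ => ha, fun i hi => (Nat.not_lt_zero i hi).elim⟩
    have hstep : ∀ a ∈ X, ∀ b ∈ X, dist a b < η₁ / 2 → P a b := by
      intro a ha b hb hab
      obtain ⟨m, p, hp0, hpm, hpX, hpd⟩ := hrefl a ha
      obtain ⟨q, hq0, hqm, hqX, hqd⟩ := chain_snoc hp0 hpm hpX hpd hb hab
      exact ⟨m + 1, q, hq0, hqm, hqX, hqd⟩
    have htrans : ∀ a b c, a ∈ X → b ∈ X → c ∈ X → P a b → P b c → P a c := by
      rintro a b c - - - ⟨m, p, hp0, hpm, hpX, hpd⟩ ⟨m', q, hq0, hqm, hqX, hqd⟩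
      obtain ⟨r, n, hr0, hrn, hrX, hrd⟩ := chain_append hp0 hpm hpX hpd hq0 hqm hqX hqd
      exact ⟨n, r, hr0, hrn, hrX, hrd⟩
    refine hXp.induction₂' P (fun z hz => ?_) htrans hx₀ hx
    filter_upwards [self_mem_nhdsWithin, mem_nhdsWithin_of_mem_nhds (ball_mem_nhds z (half_pos hη₁))]
      with y hyX hyB
    rw [mem_ball] at hyB
    exact ⟨hstep z hz y hyX (by rwa [dist_comm]), hstep y hyX z hz hyB⟩
  have hchain : ∃ n : ℕ, ∀ x ∈ X, ∃ m ≤ n, ∃ p : ℕ → ℂ, p 0 = x₀ ∧ p m = x ∧ (∀ i ≤ m, p i ∈ X) ∧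
      ∀ i < m, dist (p i) (p (i + 1)) < η₁ / 2 := by
    refine hXc.induction_on (p := fun t => ∃ n : ℕ, ∀ x ∈ t, ∃ m ≤ n, ∃ p : ℕ → ℂ, p 0 = x₀ ∧ p m = x ∧
      (∀ i ≤ m, p i ∈ X) ∧ ∀ i < m, dist (p i) (p (i + 1)) < η₁ / 2) ?_ ?_ ?_ ?_
    · exact ⟨0, fun x hx => hx.elim⟩
    · rintro s t hst ⟨n, hn⟩
      exact ⟨n, fun x hx => hn x (hst hx)⟩
    · rintro s t ⟨n, hn⟩ ⟨n', hn'⟩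
      refine ⟨max n n', fun x hx => ?_⟩
      rcases hx with hx | hx
      · obtain ⟨m, hm, hp⟩ := hn x hx
        exact ⟨m, hm.trans (le_max_left _ _), hp⟩
      · obtain ⟨m, hm, hp⟩ := hn' x hx
        exact ⟨m, hm.trans (le_max_right _ _), hp⟩
    · intro z hz
      obtain ⟨m, p, hp0, hpm, hpX, hpd⟩ := hreach z hz
      refine ⟨X ∩ ball z (η₁ / 2), inter_mem_nhdsWithin X (ball_mem_nhds z (half_pos hη₁)), m + 1, ?_⟩
      rintro y ⟨hyX, hyB⟩
      rw [mem_ball] at hyB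
      obtain ⟨q, hq0, hqm, hqX, hqd⟩ := chain_snoc hp0 hpm hpX hpd hyX (by rwa [dist_comm])
      exact ⟨m + 1, le_rfl, q, hq0, hqm, hqX, hqd⟩
  obtain ⟨nC, hnC⟩ := hchain
  set B : ℝ := nC + 1 with hB
  have hosc : ∀ᶠ k in atTop, ∀ x ∈ S k, ‖g k x - g k (π k x₀)‖ ≤ B := by
    filter_upwards [hequi₁, hπ (η₁ / 4) (by positivity)] with k hek hπk
    intro x hx
    obtain ⟨m, hm, p, hp0, hpm, hpX, hpd⟩ := hnC x (hSX k hx)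
    let q : ℕ → ℂ := fun i => if i < m then π k (p i) else x
    have hqS : ∀ i ≤ m, q i ∈ S k := by
      intro i hi
      by_cases h : i < m
      · simp only [q, h, if_true]; exact (hπk _ (hpX i hi)).1
      · simp only [q, h, if_false]; exact hx
    have hqd : ∀ i < m, dist (q i) (q (i + 1)) < η₁ := by
      intro i hi
      have h1 : dist (q i) (p i) < η₁ / 4 := by
        simp only [q, hi, if_true]; rw [dist_comm]; exact (hπk _ (hpX i hi.le)).2
      have h2 : dist (p (i + 1)) (q (i + 1)) < η₁ / 4 := by
        by_cases h : i + 1 < m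
        · simp only [q, h, if_true]; exact (hπk _ (hpX _ h.le)).2
        · have h' : i + 1 = m := by omega
          simp only [q, h, if_false]
          rw [h', hpm, dist_self]; positivity
      calc dist (q i) (q (i + 1)) ≤ dist (q i) (p i) + dist (p i) (p (i + 1)) + dist (p (i + 1)) (q (i + 1)) :=
            dist_triangle4 _ _ _ _
        _ < η₁ / 4 + η₁ / 2 + η₁ / 4 := by gcongr; exact hpd i hi
        _ = η₁ := by ring
    have hind : ∀ j ≤ m, ‖g k (q j) - g k (q 0)‖ ≤ j := by
      intro j hj
      induction j with
      | zero => simp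
      | succ j ih =>
        have hstep := hek (q (j + 1)) (hqS _ hj) (q j) (hqS _ (Nat.le_of_succ_le hj))
          (by rw [dist_comm]; exact hqd j hj)
        calc ‖g k (q (j + 1)) - g k (q 0)‖ ≤ ‖g k (q (j + 1)) - g k (q j)‖ + ‖g k (q j) - g k (q 0)‖ :=
              norm_sub_le_norm_sub_add_norm_sub _ _ _
          _ ≤ 1 + j := add_le_add hstep (ih (Nat.le_of_succ_le hj))
          _ = ((j + 1 : ℕ) : ℝ) := by push_cast; ring
    have hqm : q m = x := by simp [q]
    have hq0 : dist (q 0) (π k x₀) < η₁ := by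
      by_cases h : 0 < m
      · simp only [q, h, if_true, hp0, dist_self]; exact hη₁
      · have hm0 : m = 0 := by omega
        have : q 0 = x₀ := by simp only [q, h, if_false]; rw [← hpm, hm0, hp0]
        rw [this]
        linarith [(hπk x₀ hx₀).2]
    have h0 : ‖g k (q 0) - g k (π k x₀)‖ ≤ 1 :=
      hek (q 0) (hqS 0 (Nat.zero_le _)) _ (hπk x₀ hx₀).1 hq0
    calc ‖g k x - g k (π k x₀)‖ ≤ ‖g k x - g k (q 0)‖ + ‖g k (q 0) - g k (π k x₀)‖ :=
          norm_sub_le_norm_sub_add_norm_sub _ _ _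
      _ ≤ m + 1 := by rw [← hqm]; exact add_le_add (hind m le_rfl) h0
      _ ≤ B := by
          rw [hB]
          have : (m : ℝ) ≤ nC := by exact_mod_cast hm
          linarith
  /- Step C: the shifted nearest-point extensions `h k x = g k (π k x) − z k` are bounded and asymptotically
  equicontinuous on `X`. -/
  set zz : ℕ → ℂ := fun k => g k (π k x₀) with hzz
  set h : ℕ → ℂ → ℂ := fun k x => g k (π k x) - zz k with hh
  have hbd : ∀ᶠ k in atTop, ∀ x ∈ X, ‖h k x‖ ≤ B := by
    filter_upwards [hosc, hπ 1 one_pos] with k hk hπk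
    intro x hx
    exact hk _ (hπk x hx).1
  have hequih : ∀ ε > (0:ℝ), ∃ η > (0:ℝ), ∀ᶠ k in atTop, ∀ x ∈ X, ∀ y ∈ X, dist x y < η → ‖h k x - h k y‖ ≤ ε := by
    intro ε hε
    obtain ⟨η, hη, hek⟩ := hequi ε hε
    refine ⟨η / 3, by positivity, ?_⟩
    filter_upwards [hek, hπ (η / 3) (by positivity)] with k hk hπk
    intro x hx y hy hxy
    have h1 : h k x - h k y = g k (π k x) - g k (π k y) := by simp only [hh]; ring
    rw [h1]
    refine hk _ (hπk x hx).1 _ (hπk y hy).1 ?_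
    calc dist (π k x) (π k y) ≤ dist (π k x) x + dist x y + dist y (π k y) := dist_triangle4 _ _ _ _
      _ < η / 3 + η / 3 + η / 3 := by
          gcongr
          · rw [dist_comm]; exact (hπk x hx).2
          · exact (hπk y hy).2
      _ = η := by ring
  /- Step D: a countable dense subset of `X`, enumerated. -/
  obtain ⟨T, hTX, hTc, hXT⟩ := EMetric.subset_countable_closure_of_compact hXc
  have hTne : T.Nonempty := by
    by_contra hT
    rw [not_nonempty_iff_eq_empty] at hT
    rw [hT, closure_empty] at hXT
    exact hXT hx₀
  obtain ⟨c, hc⟩ := hTc.exists_eq_range hTne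
  have hcX : ∀ n, c n ∈ X := fun n => hTX (hc ▸ mem_range_self n)
  have hnet : ∀ η > (0:ℝ), ∃ N₀ : ℕ, ∀ x ∈ X, ∃ n < N₀, dist x (c n) < η := by
    intro η hη
    have hcov : X ⊆ ⋃ n : ℕ, ball (c n) η := by
      intro x hx
      have hx' : x ∈ closure (range c) := hc ▸ hXT hx
      obtain ⟨b, ⟨n, rfl⟩, hb⟩ := Metric.mem_closure_iff.1 hx' η hη
      exact mem_iUnion.2 ⟨n, mem_ball.2 hb⟩
    obtain ⟨t, ht⟩ := hXc.elim_finite_subcover (fun n : ℕ => ball (c n) η) (fun _ => isOpen_ball) hcov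
    refine ⟨t.sup id + 1, fun x hx => ?_⟩
    obtain ⟨n, hn, hxn⟩ := mem_iUnion₂.1 (ht hx)
    exact ⟨n, Nat.lt_succ_of_le (Finset.le_sup (f := id) hn), mem_ball.1 hxn⟩
  /- Step E: sequential compactness of `ℕ → closedBall 0 B` gives a subsequence converging on the dense set. -/
  let v : ℕ → ℕ → ℂ := fun k n => if ‖h k (c n)‖ ≤ B then h k (c n) else 0
  have hB0 : 0 ≤ B := by rw [hB]; positivity
  have hvmem : ∀ k, v k ∈ Set.pi univ fun _ : ℕ => closedBall (0 : ℂ) B := by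
    intro k n _
    simp only [v]
    split_ifs with hle
    · exact mem_closedBall_zero_iff.2 hle
    · exact mem_closedBall_zero_iff.2 (by simpa using hB0)
  obtain ⟨L, -, φ, hφ, hL⟩ :=
    (isCompact_univ_pi fun _ : ℕ => isCompact_closedBall (0 : ℂ) B).tendsto_subseq hvmem
  have hLn : ∀ n, Tendsto (fun k => v (φ k) n) atTop (𝓝 (L n)) := fun n => tendsto_pi_nhds.1 hL n
  have hφt : Tendsto φ atTop atTop := hφ.tendsto_atTop
  have hvh : ∀ᶠ k in atTop, ∀ n, v (φ k) n = h (φ k) (c n) := by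
    filter_upwards [hφt.eventually hbd] with k hk
    intro n
    simp only [v, if_pos (hk (c n) (hcX n))]
  have hconv : ∀ n, Tendsto (fun k => h (φ k) (c n)) atTop (𝓝 (L n)) := by
    intro n
    refine (hLn n).congr' ?_
    filter_upwards [hvh] with k hk
    exact hk n
  /- Step F: uniformly Cauchy on `X` along `φ`. -/
  have hUC : ∀ ε > (0:ℝ), ∃ K : ℕ, ∀ k ≥ K, ∀ l ≥ K, ∀ x ∈ X, ‖h (φ k) x - h (φ l) x‖ ≤ ε := by
    intro ε hε
    obtain ⟨η, hη, hek⟩ := hequih (ε / 3) (by positivity)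
    obtain ⟨N₀, hN₀⟩ := hnet η hη
    have hcau : ∀ n, ∃ K : ℕ, ∀ k ≥ K, ∀ l ≥ K, ‖h (φ k) (c n) - h (φ l) (c n)‖ < ε / 3 := by
      intro n
      obtain ⟨K, hK⟩ := Metric.cauchySeq_iff.1 (hconv n).cauchySeq (ε / 3) (by positivity)
      exact ⟨K, fun k hk l hl => by rw [← dist_eq_norm]; exact hK k hk l hl⟩
    choose Kf hKf using hcau
    obtain ⟨K₁, hK₁⟩ := eventually_atTop.1 (hφt.eventually hek)
    refine ⟨max K₁ ((Finset.range N₀).sup Kf), fun k hk l hl x hx => ?_⟩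
    obtain ⟨n, hn, hxn⟩ := hN₀ x hx
    have hKn : Kf n ≤ (Finset.range N₀).sup Kf := Finset.le_sup (Finset.mem_range.2 hn)
    have h1 := hK₁ k (le_of_max_le_left hk) x hx (c n) (hcX n) hxn
    have h2 := hKf n k (hKn.trans (le_of_max_le_right hk)) l (hKn.trans (le_of_max_le_right hl))
    have h3 := hK₁ l (le_of_max_le_left hl) x hx (c n) (hcX n) hxn
    calc ‖h (φ k) x - h (φ l) x‖
        ≤ ‖h (φ k) x - h (φ k) (c n)‖ + ‖h (φ k) (c n) - h (φ l) (c n)‖ + ‖h (φ l) (c n) - h (φ l) x‖ := by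
          have := norm_sub_le_norm_sub_add_norm_sub (h (φ k) x) (h (φ k) (c n)) (h (φ l) x)
          have := norm_sub_le_norm_sub_add_norm_sub (h (φ k) (c n)) (h (φ l) (c n)) (h (φ l) x)
          linarith
      _ ≤ ε / 3 + ε / 3 + ε / 3 := by
          gcongr
          rw [norm_sub_rev]; exact h3
      _ = ε := by ring
  /- Step G: the limit `G`, uniform convergence on `X`, continuity. -/
  have hcauchy : ∀ x ∈ X, CauchySeq fun k => h (φ k) x := by
    intro x hx
    refine Metric.cauchySeq_iff.2 fun ε hε => ?_
    obtain ⟨K, hK⟩ := hUC (ε / 2) (half_pos hε)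
    exact ⟨K, fun k hk l hl => by rw [dist_eq_norm]; linarith [hK k hk l hl x hx]⟩
  let G : ℂ → ℂ := fun x => limUnder atTop fun k => h (φ k) x
  have hG : ∀ x ∈ X, Tendsto (fun k => h (φ k) x) atTop (𝓝 (G x)) := fun x hx =>
    tendsto_nhds_limUnder (cauchySeq_tendsto_of_complete (hcauchy x hx))
  have hunif : ∀ ε > (0:ℝ), ∃ K : ℕ, ∀ k ≥ K, ∀ x ∈ X, ‖h (φ k) x - G x‖ ≤ ε := by
    intro ε hε
    obtain ⟨K, hK⟩ := hUC ε hε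
    refine ⟨K, fun k hk x hx => ?_⟩
    have ht : Tendsto (fun l => ‖h (φ k) x - h (φ l) x‖) atTop (𝓝 ‖h (φ k) x - G x‖) :=
      (tendsto_const_nhds.sub (hG x hx)).norm
    exact le_of_tendsto ht (eventually_atTop.2 ⟨K, fun l hl => hK k hk l hl x hx⟩)
  have hGc : ContinuousOn G X := by
    refine Metric.continuousOn_iff.2 fun x hx ε hε => ?_
    obtain ⟨η, hη, hek⟩ := hequih (ε / 2) (half_pos hε)
    refine ⟨η, hη, fun y hy hyx => ?_⟩
    have ht : Tendsto (fun k => ‖h (φ k) y - h (φ k) x‖) atTop (𝓝 ‖G y - G x‖) :=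
      ((hG y hy).sub (hG x hx)).norm
    have hle : ‖G y - G x‖ ≤ ε / 2 :=
      le_of_tendsto ht ((hφt.eventually hek).mono fun k hk => hk y hy x hx hyx)
    rw [dist_eq_norm]
    linarith
  /- Step H: conclusion. -/
  refine ⟨φ, fun k => zz (φ k), G, hφ, hGc, fun ε hε => ?_⟩
  obtain ⟨η, hη, hek⟩ := hequi (ε / 2) (half_pos hε)
  obtain ⟨K, hK⟩ := hunif (ε / 2) (half_pos hε)
  filter_upwards [hφt.eventually hek, hφt.eventually (hπ η hη), eventually_ge_atTop K] with k hk hπk hkK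
  intro x hx
  have hxX : x ∈ X := hSX _ hx
  have h1 : ‖g (φ k) x - g (φ k) (π (φ k) x)‖ ≤ ε / 2 := hk x hx _ (hπk x hxX).1 (hπk x hxX).2
  have h2 : ‖h (φ k) x - G x‖ ≤ ε / 2 := hK k hkK x hxX
  have h3 : g (φ k) x - zz (φ k) - G x = (g (φ k) x - g (φ k) (π (φ k) x)) + (h (φ k) x - G x) := by
    simp only [hh]; ring
  rw [h3]
  exact (norm_add_le _ _).trans (by linarith)

end Summit.CriticalPhenomena.CardyFormulaZ2.Cruxes.ParafermionToSLESixFamilies.PotentialDarbouxPicardDiamond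

end
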